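import Summits.QuantumFields.YangMills.Theorems.BalabanUVNodesN27AtRecord11
import Summits.QuantumFields.YangMills.Theorems.BalabanUVNodesSpineCarriersOfRecord13CoPR
import Summits.QuantumFields.YangMills.Theorems.BalabanUVNodesRateCarriersOfRecord13CoPR

/-!
# BalabanUVNodes ∕ N27 = binder B5 AT THE RECORD, XXXVIIIᶜᵒᴾᴿ — N27 AT THE CoPR-KEYED STAGE-13 CARRIER HOMES OF RECORD: B5 `Spine ₁₃CCoPR` from the one-application stub instances at (T-SPINE)
# `YMDAG.UVSplit.SRec₁₃CoPR cr` (`…SpineCarriersOfRecord13CoPR`) and (T-RATE) `YMDAG.UVSplit.RRec₁₃CoPR 𝔯` (dag-n22-e 1″ᶜᵒᴾᴿ `…RateCarriersOfRecord13CoPR`, keyed by RR-2's `Node00.IsDatumOfRecord₁₃CCoPR` ∕ `.params`)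
# and the N19′ edge at the homes' own keys, `S_R00x` discharged by name (`s_R00x_rRec₁₃CoPR`): THE v1.6 `CoPR` EDITION OF MODULE XXXVIII `…N27AtRecord13Home` (p494468 ‴ ∕ p509319 ⁗)
# (cell `pub-ymgap`, HUMAN RULING D-0062 Track A, R134 seat `pub-ymgap-dag-n27-c` (s2) gen 8; `--kind proof --supports <K3 id of record> --as helper`; COUNT-NEUTRAL; `N`-generic, NO Theses import)

WHY THIS EDITION (v1.6 `CoPR` = RECORD 13 WITH THE RUN-INDEXED RESIDUAL 𝐓-WEIGHT SLOT `Zr` — director-ym №169 H1 ∕ №174 PRESS WORD ∕ №176, FINDING №8; def-T FILE 25 `Node00/Record13CoPR.lean`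
p529474 ✓ + 26T `Node00/Record13SepCoPR.lean` p529780 ✓ (KEY-RULE-25), RR-2 `Node00/Record13DatumKeyCoPR.lean` p531309 ✓ ∕ `…KeySepCoPR`; route rev 22∕23, dag-lead WORDS-142: K3⁶
`SpineGivenEndpointR13SepCoPR` = stmt-QuantumFields-20509, the ⁵ items aside): this file is the T₆ image of my v1.5 storey `…N27AtRecord13CoPHome (XXXVIIIᶜᵒᴾ)` (p526974 ✓), which STANDS as a landed sibling —
binder `θ : Node00.Stage13Params F N ↦ θ : Node00.Stage13RParams F N` (`extends Stage13Params` by the ONE field `Zr : (p : B12.RunParams) → TkResidualW Fam N (FluctV N) p.K`), core provisos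
`θ.Provisos₁₃Core ↦ θ.Provisos₁₃CoPR` (v1.2's rows at `θ.toStage13Params` + `zrLaws ∕ zrLocal`), datum ∕ tower ∕ record ∕ shadow ∕ faces `…₁₃CoP ↦ …₁₃CoPR` (`datumOfRecord₁₃CoPR θ h` reads the
run's 𝐓-weights `WtOfRecord₁₃R θ p := tkWeightsOfRecordP … (gOfRecord₁₃ F N θ.toStage13Params p) (θ.Zr p)`), guard `θ.ZtUnity ↦ θ.ZrUnity` (RR-2 `unityNondeg₁₃ ↦ unityNondeg₁₃R`), RR-2's ∕
the carriers' ∕ my stems `CoP ↦ CoPR`; θ-level objects NOT re-issued are cited at `θ.toStage13Params` (SITE-RULE; `θ.γ`, `θ.τ9`, `θ.Admissible`, `θ.SlotsNondegenerate₁₃`, `θ.toStage12Params`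
through `extends`).  bg-BLIND and proviso-FIELD-blind as before: the provisos enter ONLY as the binder type `hc : θ.Provisos₁₃CoPR F N` and inside `datumOfRecord₁₃CoPR F N θ hc` (keyed ONCE; the
item edition's tuple `(θ, h : θ.Provisos₁₃SepCoPR F N)` applies it at `hc := h.toCore`, datum `rfl` by def-T's `datumOfRecord₁₃SepCoPR_eq_coPR`).  Statements AND proofs = the v1.5 module's,
token for token under T₆; NO bridge to ∕ from the v1.5 storeys is stated (different data: `Zr p` per run vs `Zt p.K` per length; the ONE-WAY door ⁵ → ⁶ is def-T's `Stage13RParams.ofRunBlind`).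

THE KNIT.  XIV `spine_of_rateStubs_coreEdge` at `Rec := Node00.IsRecordOfRecord₁₃CCoPR F N`, `SRec := SRec₁₃CoPR cr`, `RRec := RRec₁₃CoPR 𝔯`:
* `S_R00x ₁₃CCoPR (RRec₁₃CoPR 𝔯)` — PROVED at the home (`YMDAG.UVSplit.s_R00x_rRec₁₃CoPR`: the run-length-0 bundle at the record's own datum key; existence of residual objects is free),
  so it is NOT a hypothesis here;
* `S_N14`–`S_N18`, `S_N22` at `RRec₁₃CoPR 𝔯` — the home's one-application instances (`s_N14_rRec₁₃CoPR_iff` … `s_N22_rRec₁₃CoPR_iff`), HYPOTHESES;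
* `S_N27x ₁₃CCoPR (SRec₁₃CoPR cr)`, `S_N20`, `S_N21` at `SRec₁₃CoPR cr` — the home's instances (`s_N27x_sRec₁₃CoPR_of`, `s_N20_sRec₁₃CoPR_iff`, `s_N21_sRec₁₃CoPR_iff`), HYPOTHESES;
* the N19′ ∃δ-edge AT THE TWO HOMES' KEYS (`h19`): for every admissible Stage-13 `θ` with provisos, every `g₀`, `os`, every datum key `h : IsDatumOfRecord₁₃CCoPR F N (datumOfRecord₁₃CoPR F N θ hP)`
  of θ's own datum and every run length `k`: the six rates at the CANONICAL rate bundle `rateCarriersOfRecord₁₃CoPR 𝔯 F h.params h.provisos g₀ os k` give SOME summable `δ` carrying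
  `Spine.NE7.Core` on the shell-free cores of `cr F θ hP g₀ os` (`coreEdge_of_homes₁₃CoPR`).

WHAT IS KERNEL-CHECKED ([bookkeeping]; 0 `def`, 0 `sorry`): `coreEdge_of_homes₁₃CoPR` · **`spine_rec13CCoPR_of_homes₁₃CoPR`** (the knit above ⇒ `Spine ₁₃CCoPR`) · `spine_rec13CCoPR_of_homes₁₃CoPR_faces` (the same with
the spine-side stubs replaced by their θ-indexed readings through the home's faces: N20 `RelWeightBound` ∕ N21 `ShellWeightBound` at `cr F θ hP g₀ os`, N27x's unconditional θ-form).

HONEST FRAMING.  COMPOSITE-node bookkeeping: every K4∕K5 stub and the edge are HYPOTHESES with NO producer at the Stage-13 record today (0∕1; the children's ₁₃ re-keying is in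
progress); the readings `cr`, `𝔯` are PARAMETERS of the homes (no reading of Bałaban's dressed expansion ∕ dressed tower of record exists); `S_R00x` is discharged only because residual
objects exist by construction (located, not content); nothing of Bałaban's asserted; NE7 ∕ NE7b ∕ NE7c NOT PRINTED for d = 4 and NOT PROVED; NO node discharged; K3 NOT claimed; no ₁₃
inhabitant claimed (K0 open); counts UNMOVED (typed 28∕28 · discharged 5∕27, A 5∕28); one finite four-torus programme at fixed `ε` — NOT ℝ⁴, NOT infinite volume, NOT OS, NOT a mass
gap, NOT Clay.  No decl below carries a cite tag.
-/

namespace Summit.QuantumFields.YangMills.Theorems.BalabanUVNodesN27SpineRecord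

open Literature.MathematicalPhysics.QuantumFieldTheory.Balaban1983to89
open Literature.MathematicalPhysics.QuantumFieldTheory.Balaban1983to89.T4Continuum
open T4WeightBudget (RelWeightBound)
open T4IndicatorShell (ShellWeightBound)
open T4ContinuumYM4Torus (ForSmallCouplings)
open Summit.QuantumFields.BalabanUV.T4Continuum.Spine
open YMDAG.UVSplit
open Node00 (Stage13RParams datumOfRecord₁₃CoPR IsRecordOfRecord₁₃CCoPR IsDatumOfRecord₁₃CCoPR)

variable {N : ℕ} [NeZero N] (cr : SpineReading₁₃CoPR N) (𝔯 : RateReading₁₃CoPR N)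

/-! ## §1 The N19′ edge at the two homes' keys -/

/-- **XIV's N19′ EDGE AT `(SRec₁₃CoPR cr, RRec₁₃CoPR 𝔯)`**: a bundle pinned by `SRec₁₃CoPR cr` is `cr F θ hP g₀ os` for an admissible θ with provisos realising `D`; rate carriers pinned by `RRec₁₃CoPR 𝔯` at
the same `D` are a run length `k` of the canonical bundle at a datum key of `D`; so the edge XIV consumes is the HOME-KEYED pair form `h19`. [bookkeeping] -/
theorem coreEdge_of_homes₁₃CoPR
    (h19 : ∀ (F : T4Family) (θ : Stage13RParams F N) (hP : θ.Provisos₁₃CoPR F N), θ.Admissible F N → ∀ (g₀ : ℕ → ℝ) (os : List (ULoop F))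
      (h : IsDatumOfRecord₁₃CCoPR F N (datumOfRecord₁₃CoPR F N θ hP)) (k : ℕ),
      RatesAt (datumOfRecord₁₃CoPR F N θ hP) (rateCarriersOfRecord₁₃CoPR 𝔯 F h.params h.provisos g₀ os k) → letI := (cr F θ hP g₀ os).dec
        ∃ δ : ℕ → ℝ, NE7.Core (cr F θ hP g₀ os).l₀ (cr F θ hP g₀ os).vol (cr F θ hP g₀ os).T (cr F θ hP g₀ os).Bad
          (fun K t τ => (cr F θ hP g₀ os).A K t τ - (cr F θ hP g₀ os).shA K t τ) (fun K t τ => (cr F θ hP g₀ os).B K t τ - (cr F θ hP g₀ os).shB K t τ) δ ∧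
          Summable δ)
    (F : T4Family) (D : Datum F N) (g₀ : ℕ → ℝ) (os : List (ULoop F)) (S : SpineCarriers) (R : RateCarriers N)
    (hS : SRec₁₃CoPR cr F D g₀ os S) (hR : RRec₁₃CoPR 𝔯 F D g₀ os R) (hrates : RatesAt D R) : letI := S.dec
      ∃ δ : ℕ → ℝ, NE7.Core S.l₀ S.vol S.T S.Bad (fun K t τ => S.A K t τ - S.shA K t τ) (fun K t τ => S.B K t τ - S.shB K t τ) δ ∧ Summable δ := by
  obtain ⟨θ, hP, hθ, rfl, rfl⟩ := hS
  obtain ⟨h, k, rfl⟩ := hR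
  exact h19 F θ hP hθ g₀ os h k hrates

/-! ## §2 The knit at the homes -/

/-- **N27 = B5 AT THE STAGE-13 RECORD FROM THE STUB INSTANCES OF THE TWO CARRIER HOMES OF RECORD AND THE HOME-KEYED N19′ EDGE — `S_R00x` DISCHARGED BY NAME.**  XIV
`spine_of_rateStubs_coreEdge` at `(₁₃CCoPR, SRec₁₃CoPR cr, RRec₁₃CoPR 𝔯)` with `hx := s_R00x_rRec₁₃CoPR 𝔯` (home theorem): the six K4 stubs at `RRec₁₃CoPR 𝔯`, the three K5 stubs at `SRec₁₃CoPR cr` and `h19` give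
`Spine ₁₃CCoPR`.  Every remaining stub a HYPOTHESIS (0∕1 today). [bookkeeping] -/
theorem spine_rec13CCoPR_of_homes₁₃CoPR (h14 : S_N14 (RRec₁₃CoPR 𝔯)) (h15 : S_N15 (RRec₁₃CoPR 𝔯)) (h16 : S_N16 (RRec₁₃CoPR 𝔯)) (h17 : S_N17 (RRec₁₃CoPR 𝔯))
    (h18 : S_N18 (RRec₁₃CoPR 𝔯)) (h22 : S_N22 (RRec₁₃CoPR 𝔯)) (hx' : S_N27x (fun F D w => IsRecordOfRecord₁₃CCoPR F N D w) (SRec₁₃CoPR cr)) (h20 : S_N20 (SRec₁₃CoPR cr))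
    (h21 : S_N21 (SRec₁₃CoPR cr))
    (h19 : ∀ (F : T4Family) (θ : Stage13RParams F N) (hP : θ.Provisos₁₃CoPR F N), θ.Admissible F N → ∀ (g₀ : ℕ → ℝ) (os : List (ULoop F))
      (h : IsDatumOfRecord₁₃CCoPR F N (datumOfRecord₁₃CoPR F N θ hP)) (k : ℕ),
      RatesAt (datumOfRecord₁₃CoPR F N θ hP) (rateCarriersOfRecord₁₃CoPR 𝔯 F h.params h.provisos g₀ os k) → letI := (cr F θ hP g₀ os).dec
        ∃ δ : ℕ → ℝ, NE7.Core (cr F θ hP g₀ os).l₀ (cr F θ hP g₀ os).vol (cr F θ hP g₀ os).T (cr F θ hP g₀ os).Bad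
          (fun K t τ => (cr F θ hP g₀ os).A K t τ - (cr F θ hP g₀ os).shA K t τ) (fun K t τ => (cr F θ hP g₀ os).B K t τ - (cr F θ hP g₀ os).shB K t τ) δ ∧
          Summable δ) :
    Spine (N := N) fun F D w => IsRecordOfRecord₁₃CCoPR F N D w :=
  spine_of_rateStubs_coreEdge _ (SRec₁₃CoPR cr) (RRec₁₃CoPR 𝔯) (s_R00x_rRec₁₃CoPR 𝔯) h14 h15 h16 h17 h18 h22 hx' h20 h21 (coreEdge_of_homes₁₃CoPR cr 𝔯 h19)

/-- **THE SAME WITH THE SPINE-SIDE STUBS READ THROUGH THE HOME's FACES**: N20 `RelWeightBound` and N21 `ShellWeightBound` at `cr F θ hP g₀ os` for every admissible Stage-13 θ with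
provisos (`s_N20_sRec₁₃CoPR_iff` ∕ `s_N21_sRec₁₃CoPR_iff`), and N27x's unconditional θ-form (`s_N27x_sRec₁₃CoPR_of`: positivity + E1∕E2 against the datum's dressed partition functions at every
admissible θ); rate stubs as in `spine_rec13CCoPR_of_homes₁₃CoPR`. [bookkeeping] -/
theorem spine_rec13CCoPR_of_homes₁₃CoPR_faces (h14 : S_N14 (RRec₁₃CoPR 𝔯)) (h15 : S_N15 (RRec₁₃CoPR 𝔯)) (h16 : S_N16 (RRec₁₃CoPR 𝔯)) (h17 : S_N17 (RRec₁₃CoPR 𝔯))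
    (h18 : S_N18 (RRec₁₃CoPR 𝔯)) (h22 : S_N22 (RRec₁₃CoPR 𝔯))
    (hx : ∀ (F : T4Family) (θ : Stage13RParams F N) (hP : θ.Provisos₁₃CoPR F N), θ.Admissible F N → ∀ (g₀ : ℕ → ℝ) (os : List (ULoop F)),
      0 < (cr F θ hP g₀ os).l₀ ∧ 0 < (cr F θ hP g₀ os).vol ∧
        (∀ (K : ℕ) (t : ℝ), |t| ≤ (cr F θ hP g₀ os).l₀ →
          T4GenFunBounds.schemeZ ((datumOfRecord₁₃CoPR F N θ hP).scheme g₀) os ((cr F θ hP g₀ os).K₀ + K) t =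
            ∑ τ ∈ (cr F θ hP g₀ os).T K, (cr F θ hP g₀ os).A K t τ) ∧
        (∀ (K : ℕ) (t : ℝ), |t| ≤ (cr F θ hP g₀ os).l₀ →
          T4GenFunBounds.schemeZ ((datumOfRecord₁₃CoPR F N θ hP).scheme g₀) os ((cr F θ hP g₀ os).K₀ + K + 1) t =
            ∑ τ ∈ (cr F θ hP g₀ os).T K, (cr F θ hP g₀ os).B K t τ))
    (h20 : ∀ (F : T4Family) (θ : Stage13RParams F N) (hP : θ.Provisos₁₃CoPR F N), θ.Admissible F N → ∀ (g₀ : ℕ → ℝ) (os : List (ULoop F)),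
      RelWeightBound (cr F θ hP g₀ os).l₀ (cr F θ hP g₀ os).T (cr F θ hP g₀ os).A (cr F θ hP g₀ os).B (cr F θ hP g₀ os).Bad (cr F θ hP g₀ os).W)
    (h21 : ∀ (F : T4Family) (θ : Stage13RParams F N) (hP : θ.Provisos₁₃CoPR F N), θ.Admissible F N → ∀ (g₀ : ℕ → ℝ) (os : List (ULoop F)),
      ShellWeightBound (cr F θ hP g₀ os).l₀ (cr F θ hP g₀ os).T (cr F θ hP g₀ os).A (cr F θ hP g₀ os).B (cr F θ hP g₀ os).shA (cr F θ hP g₀ os).shB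
        (cr F θ hP g₀ os).Wsh)
    (h19 : ∀ (F : T4Family) (θ : Stage13RParams F N) (hP : θ.Provisos₁₃CoPR F N), θ.Admissible F N → ∀ (g₀ : ℕ → ℝ) (os : List (ULoop F))
      (h : IsDatumOfRecord₁₃CCoPR F N (datumOfRecord₁₃CoPR F N θ hP)) (k : ℕ),
      RatesAt (datumOfRecord₁₃CoPR F N θ hP) (rateCarriersOfRecord₁₃CoPR 𝔯 F h.params h.provisos g₀ os k) → letI := (cr F θ hP g₀ os).dec
        ∃ δ : ℕ → ℝ, NE7.Core (cr F θ hP g₀ os).l₀ (cr F θ hP g₀ os).vol (cr F θ hP g₀ os).T (cr F θ hP g₀ os).Bad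
          (fun K t τ => (cr F θ hP g₀ os).A K t τ - (cr F θ hP g₀ os).shA K t τ) (fun K t τ => (cr F θ hP g₀ os).B K t τ - (cr F θ hP g₀ os).shB K t τ) δ ∧
          Summable δ) :
    Spine (N := N) fun F D w => IsRecordOfRecord₁₃CCoPR F N D w :=
  spine_rec13CCoPR_of_homes₁₃CoPR cr 𝔯 h14 h15 h16 h17 h18 h22 (s_N27x_sRec₁₃CoPR_of cr hx) ((s_N20_sRec₁₃CoPR_iff cr).mpr h20) ((s_N21_sRec₁₃CoPR_iff cr).mpr h21) h19

end Summit.QuantumFields.YangMills.Theorems.BalabanUVNodesN27SpineRecord
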